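import Mathlib
import Summits.QuantumFields.QCD.Theses.EulerDescent
import Summits.QuantumFields.QCD.Theorems.RayDescent.Negative.TrivialSlices
import Summits.QuantumFields.QCD.Theorems.RayDescent.Negative.CornerPinLoadBearing

/-!
# Stub `stub_repinInvariance` of line `Sketch` for crux `EulerDescent.RayDescent`
(item stmt-QuantumFields-16900, route route-QuantumFields-EulerDescent, sub-problem QCD) —
the two FREE SLICES (supports; the stub itself is lattice-QCD physics and stays open)

The registered stub (B) says: re-pinning the critical mass of a regularisation `reg` to a sequence
`mc` with `(reg.mcrit k − mc k)·Z_m(k)/a_k → 0` costs at most an arbitrarily small loss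
`Δ ↦ Δ' < Δ` in the volume-uniform lattice gap `QCDScheme.HasLatticeMassGap` at every positive mass
tuple.  The re-pinned scheme `{reg with mcrit := mc}.scheme m 0 0` has bare trajectory
`reg.mcrit k + a_k (m_f − e_k)/Z_m(k)`, `e_k := (reg.mcrit k − mc k) Z_m(k)/a_k → 0`, a
`k`-DEPENDENT perturbation of the tuple `m`; nothing in the tree compares the gap clause at two bare
trajectories that are not eventually equal (`hasLatticeMassGap_congr`) or rescaled copies of each
other (`gap_iff_of_rescaled`), so the general case needs a sub-resolution continuity statement of
lattice QCD that is not available.  What IS free, and is proved here without any corner, pin,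
scaling or branch hypothesis:

* `hasLatticeMassGap_congr_eventually` — the gap clause is an `∀ᶠ k` statement reading only
  `a, β, L` and the bare masses, so it transfers between schemes whose bare trajectories agree
  EVENTUALLY (sharpening `hasLatticeMassGap_congr`, which asks pointwise equality).
* `stub_repinInvariance_of_eventuallyEq` — the slice `mc k = reg.mcrit k` eventually (pin error
  eventually ZERO, not merely `→ 0`): the conclusion of (B) holds at every rate `Δ' ≤ Δ`
  (`hasLatticeMassGap_mono`).
* `stub_repinInvariance_zero` — the `N_f = 0` slice of (B), verbatim: its corner disjunction is
  unsatisfiable (`not_eventually_corner_zero`: at `N_f = 0` the non-massive set of degenerate bare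
  masses is `∅` or `univ`, which has no least upper bound), so the slice holds vacuously.

Def-free theorem file. [folklore]
-/

noncomputable section

namespace Summit.QuantumFields.QCD.Cruxes.RayDescent.Sketch

open scoped Topology
open Filter
open Literature.MathematicalPhysics.QuantumFieldTheory
open Summit.QuantumFields.QCD.Theorems.RayDescentNegative

/-- **Gap transport along EVENTUALLY equal lattice data**: `HasLatticeMassGap` is an `∀ᶠ k`
clause reading only `a, β, L` and the bare masses `m_f(k)`, so it passes between two schemes with
the same `a, β, L` whose bare trajectories agree for all large `k`. [folklore] -/
theorem hasLatticeMassGap_congr_eventually {Nf : ℕ} {s₁ s₂ : QCDScheme Nf}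
    (ha : ∀ k, s₁.a k = s₂.a k) (hβ : ∀ k, s₁.β k = s₂.β k) (hL : ∀ k, s₁.L k = s₂.L k)
    (hmq : ∀ᶠ k in atTop, ∀ f, s₁.mq f k = s₂.mq f k) {Δ : ℝ} (h : s₁.HasLatticeMassGap Δ) :
    s₂.HasLatticeMassGap Δ := by
  intro R R' A B
  obtain ⟨C, hC⟩ := h R R' A B
  refine ⟨C, ?_⟩
  filter_upwards [hC, hmq] with k hk hk' S hS n hn
  have h1 := hk S (by rw [hL]; exact hS) n hn
  have e1 : (fun fl => s₁.mq fl k) = fun fl => s₂.mq fl k := funext fun fl => hk' fl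
  rw [e1, hβ k, ha k] at h1
  exact h1

/-- **Slice of (B) with eventually EXACT pin.** If the candidate corner `mc` eventually coincides
with `reg.mcrit`, the re-pinned scheme `{reg with mcrit := mc}.scheme m 0 0` has eventually the same
bare trajectory as `reg.scheme m 0 0`, so a uniform lattice gap `Δ` at `m` passes to it at every
rate `Δ' ≤ Δ` — no corner, scaling or branch hypothesis is needed. The content of the registered
stub is entirely in pin errors `e_k → 0` that are NOT eventually zero. [folklore] -/
theorem stub_repinInvariance_of_eventuallyEq {Nf : ℕ} (reg : QCDRegularisation Nf) (mc : ℕ → ℝ)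
    (heq : ∀ᶠ k in atTop, mc k = reg.mcrit k) (m : Fin Nf → ℝ) {Δ Δ' : ℝ}
    (hgap : (reg.scheme m 0 0).HasLatticeMassGap Δ) (hle : Δ' ≤ Δ) :
    (({ reg with mcrit := mc } : QCDRegularisation Nf).scheme m 0 0).HasLatticeMassGap Δ' := by
  have hev : ∀ᶠ k in atTop, ∀ f, (reg.scheme m 0 0).mq f k =
      (({ reg with mcrit := mc } : QCDRegularisation Nf).scheme m 0 0).mq f k := by
    filter_upwards [heq] with k hk f
    show reg.mcrit k + reg.a k * m f / reg.Zm k = mc k + reg.a k * m f / reg.Zm k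
    rw [hk]
  have h1 : (({ reg with mcrit := mc } : QCDRegularisation Nf).scheme m 0 0).HasLatticeMassGap Δ :=
    hasLatticeMassGap_congr_eventually (s₁ := reg.scheme m 0 0)
      (s₂ := ({ reg with mcrit := mc } : QCDRegularisation Nf).scheme m 0 0)
      (fun _ => rfl) (fun _ => rfl) (fun _ => rfl) hev hgap
  exact hasLatticeMassGap_mono _ h1 hle

/-- **The `N_f = 0` slice of (B), verbatim, is vacuous**: at `N_f = 0` neither disjunct of the
corner hypothesis can hold (`not_eventually_corner_zero`), so the registered statement specialised
to `Nf = 0` is provable outright — and carries no evidence for `N_f ≥ 1`. [folklore] -/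
theorem stub_repinInvariance_zero :
    ∀ (reg : QCDRegularisation 0) (mc : ℕ → ℝ),
      ((∀ᶠ k in atTop, IsLUB {μ : ℝ | ¬ (∀ (R R' : ℕ) (A : QCDLatticeObservable 0 R)
          (B : QCDLatticeObservable 0 R'), ∃ (C δ : ℝ) (S₀ : ℕ), 0 < δ ∧ ∀ S : ℕ, S₀ ≤ S →
            ∀ n : ℕ, n ≤ S → ‖qcdLatticeConnectedCorr (reg.β k) (2 * S + 1) (fun _ : Fin 0 => μ)
              A B n‖ ≤ C * Real.exp (-(δ * n)))} (reg.mcrit k)) ∨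
        (∀ᶠ k in atTop, IsLUB {μ : ℝ | ¬ (∀ (R R' : ℕ) (A : QCDLatticeObservable 0 R)
          (B : QCDLatticeObservable 0 R'), ∃ (C δ : ℝ) (S₀ : ℕ), 0 < δ ∧ ∀ S : ℕ, S₀ ≤ S →
            ∀ n : ℕ, n ≤ S → ‖qcdLatticeConnectedCorr (reg.β k) (2 * S + 1) (fun _ : Fin 0 => μ)
              A B n‖ ≤ C * Real.exp (-(δ * n)))} (mc k))) →
      Tendsto (fun k => (reg.mcrit k - mc k) * reg.Zm k / reg.a k) atTop (𝓝 0) →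
      reg.HasMassScaling → (reg.scheme 0 0 0).HasAsymptoticScaling →
      ∀ m : Fin 0 → ℝ, (∀ f, 0 < m f) →
        (∀ᶠ k in atTop, ∀ f, (-1 : ℝ) < reg.mcrit k + reg.a k * m f / reg.Zm k ∧
          (-1 : ℝ) < mc k + reg.a k * m f / reg.Zm k) →
        ∀ Δ : ℝ, 0 < Δ → (reg.scheme m 0 0).HasLatticeMassGap Δ →
          ∀ Δ' : ℝ, 0 < Δ' → Δ' < Δ →
            (({ reg with mcrit := mc } : QCDRegularisation 0).scheme m 0 0).HasLatticeMassGap Δ' := by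
  intro reg mc hcorner
  exact (hcorner.elim (not_eventually_corner_zero reg reg.mcrit)
    (not_eventually_corner_zero reg mc)).elim

end Summit.QuantumFields.QCD.Cruxes.RayDescent.Sketch

end
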